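import Mathlib.RingTheory.Nullstellensatz
import Mathlib.RingTheory.Localization.FractionRing
import Mathlib.RingTheory.AlgebraicIndependent.TranscendenceBasis
import Literature.NumberTheory.Transcendental.ExpVarieties
import Literature.RingTheory.KrullDimension.AffineDimension
import HarnessLib

/-!
# Zariski dimension via function fields: generic points and images under `[M]`

Dimension-theoretic toolkit for the vocabulary of `ExpVarieties.lean` (subsets of
`F^{n ⊕ n} ⊇ Gⁿ = Fⁿ × (Fˣ)ⁿ`, `Literature.NumberTheory.Transcendental.zariskiDim`, `Literature.NumberTheory.Transcendental.IsIrreducibleClosed`, `Literature.NumberTheory.Transcendental.torusLocus`, the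
monomial maps `Literature.matrixAct M`), over an algebraically closed field `F`:

* `Literature.NumberTheory.Transcendental.isIrreducibleClosed_zeroLocus` — the zero set `Z(P)` of a prime ideal is an irreducible
  closed set with `I(Z(P)) = P` (Nullstellensatz), and `zariskiDim F Z(P) = dim F[X]/P`
  (`Literature.NumberTheory.Transcendental.zariskiDim_zeroLocus_eq`), `= trdeg_F (F[X]/P)` (`AffineDimension.lean`);
* `Literature.NumberTheory.Transcendental.zariskiDim_zeroLocus_ker` — for an `F`-algebra map `φ : F[X] → B` into a domain,
  `zariskiDim F Z(ker φ) = trdeg_F (range φ)`;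
* the **generic point** `Literature.genericPt P ∈ K^{n ⊕ n}` of `Z(P)`, `K = Frac(F[X]/P)` the function
  field: `aeval (genericPt P) a = 0 ↔ a ∈ P`; more generally `Literature.IsGenericPt P ξ` for a point `ξ`
  of any extension field `E` with `I(ξ/F) = P` (all results below are stated for such `ξ`);
* `Literature.NumberTheory.Transcendental.exists_mul_prod_pow_eq_aeval` — clearing denominators in `h ∘ [M]`: for `h ∈ F[X, Y]`
  and `M ∈ Mₙ(ℤ)` there are `N` and `a ∈ F[X, Y]` with `h([M] z) · (∏ yᵢ)^N = a(z)` at every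
  point `z` of the torus locus of every extension field;
* `Literature.NumberTheory.Transcendental.mem_vanishingIdeal_image_matrixAct_iff` — hence the polynomials vanishing on the image
  `[M](Z(P) ∩ Gⁿ)` are exactly the kernel of evaluation at `[M] ξ` (so `[M] ξ` is a generic point
  of the closure of the image, `Literature.NumberTheory.Transcendental.IsGenericPt.matrixAct`), and
  `zariskiDim F ([M](Z(P) ∩ Gⁿ)) = trdeg_F F[[M] ξ]` (`Literature.NumberTheory.Transcendental.zariskiDim_image_matrixAct_eq`), with
  the lower bound `Literature.NumberTheory.Transcendental.le_zariskiDim_image_matrixAct` by algebraically independent coordinates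
  and the upper bounds `Literature.NumberTheory.Transcendental.zariskiDim_image_matrixAct_le_trdeg` / `_le` (`dim [M]·V ≤ dim V`) —
  the form in which rotundity (`Literature.NumberTheory.Transcendental.IsRotund`: `dim [M]·V ≥ rk M`) is verified from transcendence
  degrees (Bays–Kirby 2018, proof of Prop. 7.3: "`td(M·b/A) ≥ d rk M` iff
  `dim (M·V)^{Zar} ≥ d rk M`").

All statements are standard algebraic geometry of affine varieties over algebraically closed
fields (generic points: Zilber 2005 §3, Marker 2006 §1; Bays–Kirby 2018 §7).

## References

* H. Matsumura, *Commutative Ring Theory*, Thm 5.6 (dimension = transcendence degree).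
* M. Bays, J. Kirby, *Pseudo-exponential maps, variants, and quasiminimality*, Algebra & Number
  Theory 12 (2018), §7 (proof of Prop. 7.3).
-/

noncomputable section

open MvPolynomial Set

universe u

namespace Literature.NumberTheory.Transcendental

variable {F : Type u} [Field F]

/-! ### Zero sets of prime ideals -/

section ZeroLocus

variable {ι : Type*} [Finite ι] [IsAlgClosed F]

/-- Over an algebraically closed field, `I(Z(P)) = P` for a prime ideal `P` (Nullstellensatz), so
`Z(P)` is an irreducible Zariski closed set. [folklore] -/
theorem isIrreducibleClosed_zeroLocus (P : Ideal (MvPolynomial ι F)) [P.IsPrime] :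
    IsIrreducibleClosed F (zeroLocus F P) := by
  refine ⟨⟨P, rfl⟩, ?_⟩
  rw [MvPolynomial.IsPrime.vanishingIdeal_zeroLocus P]
  infer_instance

/-- `zariskiDim F Z(P) = dim (F[X] ⧸ P)` for a prime `P` over an algebraically closed field.
[folklore] -/
theorem zariskiDim_zeroLocus_eq (P : Ideal (MvPolynomial ι F)) [P.IsPrime] :
    zariskiDim F (zeroLocus F P) = ringKrullDim (MvPolynomial ι F ⧸ P) := by
  unfold zariskiDim
  rw [MvPolynomial.IsPrime.vanishingIdeal_zeroLocus P]

/-- `zariskiDim F Z(P) = trdeg_F (F[X] ⧸ P)` (Matsumura Thm 5.6). [cite: Matsumura1987, Thm 5.6] -/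
theorem zariskiDim_zeroLocus_eq_trdeg (P : Ideal (MvPolynomial ι F)) [P.IsPrime] :
    zariskiDim F (zeroLocus F P) =
      (Cardinal.toNat (Algebra.trdeg F (MvPolynomial ι F ⧸ P)) : WithBot ℕ∞) := by
  haveI : IsDomain (MvPolynomial ι F ⧸ P) := Ideal.Quotient.isDomain P
  rw [zariskiDim_zeroLocus_eq, Literature.RingTheory.KrullDimension.ringKrullDim_eq_trdeg F]

/-- **Dimension of `Z(ker φ)` is the transcendence degree of the image**: for an `F`-algebra map
`φ : F[X] → B` into a domain, `zariskiDim F Z(ker φ) = trdeg_F (range φ)` (the coordinate ring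
`F[X] ⧸ ker φ ≅ range φ`). [cite: Matsumura1987, Thm 5.6] -/
theorem zariskiDim_zeroLocus_ker {B : Type*} [CommRing B] [IsDomain B] [Algebra F B]
    (φ : MvPolynomial ι F →ₐ[F] B) :
    zariskiDim F (zeroLocus F (RingHom.ker φ)) =
      (Cardinal.toNat (Algebra.trdeg F φ.range) : WithBot ℕ∞) := by
  haveI : (RingHom.ker φ).IsPrime := RingHom.ker_isPrime _
  rw [zariskiDim_zeroLocus_eq_trdeg]
  -- `F[X] ⧸ ker φ ≃ₐ[F] range φ`
  have e : (MvPolynomial ι F ⧸ RingHom.ker φ) ≃ₐ[F] φ.range :=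
    (Ideal.quotientEquivAlgOfEq F (AlgHom.ker_rangeRestrict φ).symm).trans
      (Ideal.quotientKerAlgEquivOfSurjective (AlgHom.rangeRestrict_surjective φ))
  have h := congrArg Cardinal.toNat e.lift_trdeg_eq
  simp only [Cardinal.toNat_lift] at h
  rw [h]

end ZeroLocus

/-! ### The generic point of `Z(P)` -/

section GenericPoint

variable {n : ℕ} (P : Ideal (MvPolynomial (Fin n ⊕ Fin n) F))

/-- The coordinate ring `F[V] = F[X, Y] ⧸ P` of `V = Z(P)`. [folklore] -/
abbrev zeroLocusCoordRing : Type u := MvPolynomial (Fin n ⊕ Fin n) F ⧸ P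

/-- The function field `F(V) = Frac (F[X, Y] ⧸ P)` of `V = Z(P)`. [folklore] -/
abbrev zeroLocusFunctionField : Type u := FractionRing (zeroLocusCoordRing P)

/-- **The generic point** of `V = Z(P)`: the point of `F(V)^{n ⊕ n}` whose coordinates are the
classes of the coordinate functions (Zilber 2005 §3, Marker 2006 §1: a point `ζ` with
`I(ζ/F) = I(V)`, see `aeval_genericPt_eq_zero_iff`). [cite: Zilber2005, §3] -/
def genericPt : Fin n ⊕ Fin n → zeroLocusFunctionField P :=
  fun j => algebraMap (zeroLocusCoordRing P) (zeroLocusFunctionField P) (Ideal.Quotient.mk P (X j))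

/-- Evaluating a polynomial at the generic point gives its class in the function field.
[folklore] -/
theorem aeval_genericPt (a : MvPolynomial (Fin n ⊕ Fin n) F) :
    aeval (genericPt P) a = algebraMap (zeroLocusCoordRing P) (zeroLocusFunctionField P) (Ideal.Quotient.mk P a) := by
  have : (aeval (genericPt P) : MvPolynomial (Fin n ⊕ Fin n) F →ₐ[F] zeroLocusFunctionField P) =
      (IsScalarTower.toAlgHom F (zeroLocusCoordRing P) (zeroLocusFunctionField P)).comp (Ideal.Quotient.mkₐ F P) :=
    MvPolynomial.algHom_ext fun j => by simp [genericPt]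
  rw [this]; rfl

/-- **`I(ζ/F) = P`**: a polynomial vanishes at the generic point iff it lies in `P`. [cite: Zilber2005, §3] -/
theorem aeval_genericPt_eq_zero_iff (a : MvPolynomial (Fin n ⊕ Fin n) F) :
    aeval (genericPt P) a = 0 ↔ a ∈ P := by
  rw [aeval_genericPt, map_eq_zero_iff _ (IsFractionRing.injective (zeroLocusCoordRing P) (zeroLocusFunctionField P)),
    Ideal.Quotient.eq_zero_iff_mem]

/-- **Generic points of `Z(P)` over `F`** in an arbitrary `F`-algebra `E` (typically an extension
field of `F`): a point `ξ ∈ E^{n ⊕ n}` whose ideal over `F` is exactly `P`, `I(ξ/F) = P`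
(Zilber 2005 §3, Marker 2006 §1), i.e. `ker (aeval ξ) = P` (`isGenericPt_iff_ker_eq`), i.e., for `E`
a field, `vanishingIdeal F {ξ} = P` (`isGenericPt_iff_vanishingIdeal_singleton_eq`). This is the
*ideal-shaped* companion of `Literature.IsGenericOver F V z` of `ExpVarieties.lean` (`z ∈ V` and
`vanishingIdeal F {z} = vanishingIdeal F V`, for points `z` of the *same* field as `V`): here the
point lives in an extension `E` of the coefficient field `F` and the variety is given by its
prime ideal `P` — the form needed for generic points in function fields, which do not exist in
`F` itself (`isGenericOver_iff_isGenericPt` relates the two when `E = F`). Examples: the canonical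
generic point `genericPt P` (`isGenericPt_genericPt`), or its image in any extension
(`IsGenericPt.map`). [cite: Zilber2005, §3] -/
def IsGenericPt {E : Type*} [CommRing E] [Algebra F E] (ξ : Fin n ⊕ Fin n → E) : Prop :=
  ∀ a : MvPolynomial (Fin n ⊕ Fin n) F, aeval ξ a = 0 ↔ a ∈ P

/-- `IsGenericPt P ξ ↔ ker (aeval ξ) = P`. [folklore] -/
theorem isGenericPt_iff_ker_eq {E : Type*} [CommRing E] [Algebra F E] (ξ : Fin n ⊕ Fin n → E) :
    IsGenericPt P ξ ↔ RingHom.ker (aeval ξ : MvPolynomial (Fin n ⊕ Fin n) F →ₐ[F] E) = P := by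
  simp only [IsGenericPt, Ideal.ext_iff, RingHom.mem_ker]

/-- For a field `E`, `IsGenericPt P ξ ↔ vanishingIdeal F {ξ} = P` (Mathlib's two-field vanishing
ideal, coefficients in `F`, points in `E`). [folklore] -/
theorem isGenericPt_iff_vanishingIdeal_singleton_eq {E : Type*} [Field E] [Algebra F E]
    (ξ : Fin n ⊕ Fin n → E) :
    IsGenericPt P ξ ↔ vanishingIdeal F ({ξ} : Set (Fin n ⊕ Fin n → E)) = P := by
  simp only [IsGenericPt, Ideal.ext_iff, mem_vanishingIdeal_singleton_iff]

/-- Bridge to `Literature.NumberTheory.Transcendental.IsGenericOver`-style genericity for points of `F` itself: for `V = Z(P)` with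
`I(V) = P` (e.g. `P` prime and `F` algebraically closed), a point `z ∈ F^{n ⊕ n}` is a generic
point of `P` in the present sense iff `z ∈ V` and `vanishingIdeal F {z} = vanishingIdeal F V`
(the two conditions of `Literature.NumberTheory.Transcendental.IsGenericOver`, there phrased over a subfield of the point field).
[folklore] -/
theorem isGenericPt_iff_mem_and_vanishingIdeal_eq (hP : vanishingIdeal F (zeroLocus F P) = P)
    (z : Fin n ⊕ Fin n → F) :
    IsGenericPt P z ↔ z ∈ zeroLocus F P ∧
      vanishingIdeal F ({z} : Set (Fin n ⊕ Fin n → F)) = vanishingIdeal F (zeroLocus F P) := by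
  rw [isGenericPt_iff_vanishingIdeal_singleton_eq, hP]
  constructor
  · intro h
    refine ⟨?_, h⟩
    rw [mem_zeroLocus_iff]
    intro p hp
    rw [← h] at hp
    exact (mem_vanishingIdeal_singleton_iff z p).1 hp
  · exact fun h => h.2

/-- The canonical generic point is a generic point. [folklore] -/
theorem isGenericPt_genericPt : IsGenericPt P (genericPt P) :=
  aeval_genericPt_eq_zero_iff P

/-- Generic points are preserved by injective `F`-algebra maps (e.g. into an extension field).
[folklore] -/
theorem IsGenericPt.map {E E' : Type*} [CommRing E] [Algebra F E] [CommRing E'] [Algebra F E']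
    {ξ : Fin n ⊕ Fin n → E} (hξ : IsGenericPt P ξ) (g : E →ₐ[F] E') (hg : Function.Injective g) :
    IsGenericPt P (g ∘ ξ) := fun a => by
  have : aeval (g ∘ ξ) a = g (aeval ξ a) := by
    rw [← AlgHom.comp_apply, MvPolynomial.comp_aeval]; rfl
  rw [this, map_eq_zero_iff g hg, hξ a]

/-- If `Z(P)` meets the torus then no `Yᵢ` lies in `P`. [folklore] -/
theorem X_inr_notMem_of_nonempty (hne : (zeroLocus F P ∩ torusLocus F n).Nonempty) (i : Fin n) :
    (X (Sum.inr i) : MvPolynomial (Fin n ⊕ Fin n) F) ∉ P := by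
  obtain ⟨z, hzP, hzT⟩ := hne
  intro h
  have := (mem_zeroLocus_iff.1 hzP) _ h
  rw [aeval_X] at this
  exact hzT i this

/-- If `Z(P)` meets the torus then `∏ Yᵢ ∉ P`. [folklore] -/
theorem prod_X_inr_notMem_of_nonempty (hne : (zeroLocus F P ∩ torusLocus F n).Nonempty) :
    (∏ i, X (Sum.inr i) : MvPolynomial (Fin n ⊕ Fin n) F) ∉ P := by
  obtain ⟨z, hzP, hzT⟩ := hne
  intro h
  have := (mem_zeroLocus_iff.1 hzP) _ h
  rw [map_prod] at this
  simp only [aeval_X] at this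
  exact (Finset.prod_ne_zero_iff.2 fun i _ => hzT i) this

/-- A generic point lies in the torus as soon as no `Yᵢ` lies in `P`. [folklore] -/
theorem IsGenericPt.mem_torusLocus {E : Type*} [Field E] [Algebra F E] {ξ : Fin n ⊕ Fin n → E}
    (hξ : IsGenericPt P ξ) (hY : ∀ i, (X (Sum.inr i) : MvPolynomial (Fin n ⊕ Fin n) F) ∉ P) :
    ξ ∈ torusLocus E n := by
  intro i h
  have := (hξ (X (Sum.inr i))).1 (by rwa [aeval_X])
  exact hY i this

variable [P.IsPrime]

/-- The canonical generic point lies in the torus as soon as no `Yᵢ` lies in `P`. [folklore] -/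
theorem genericPt_mem_torusLocus (hY : ∀ i, (X (Sum.inr i) : MvPolynomial (Fin n ⊕ Fin n) F) ∉ P) :
    genericPt P ∈ torusLocus (zeroLocusFunctionField P) n :=
  (isGenericPt_genericPt P).mem_torusLocus P hY

variable [IsAlgClosed F]

/-- **`Z(P) ∩ Gⁿ` is dense in `Z(P)`**: if `Z(P)` meets the torus, the polynomials over `F`
vanishing on `Z(P) ∩ Gⁿ` are exactly `P`. [folklore] -/
theorem vanishingIdeal_zeroLocus_inter_torusLocus
    (hne : (zeroLocus F P ∩ torusLocus F n).Nonempty) :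
    vanishingIdeal F (zeroLocus F P ∩ torusLocus F n) = P := by
  refine le_antisymm ?_ ?_
  · intro a ha
    -- `a · ∏ Y` vanishes on `Z(P)`, hence lies in `P`; `∏ Y ∉ P`
    have h1 : a * ∏ i, X (Sum.inr i) ∈ vanishingIdeal F (zeroLocus F P) := by
      rw [mem_vanishingIdeal_iff]
      intro z hz
      by_cases hzT : z ∈ torusLocus F n
      · rw [map_mul, (mem_vanishingIdeal_iff.1 ha) z ⟨hz, hzT⟩, zero_mul]
      · simp only [mem_torusLocus_iff, not_forall, not_not] at hzT
        obtain ⟨i, hi⟩ := hzT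
        rw [map_mul, map_prod]
        simp only [aeval_X]
        rw [Finset.prod_eq_zero (Finset.mem_univ i) hi, mul_zero]
    rw [MvPolynomial.IsPrime.vanishingIdeal_zeroLocus P] at h1
    exact ((Ideal.IsPrime.mem_or_mem inferInstance h1).resolve_right
      (prod_X_inr_notMem_of_nonempty P hne))
  · intro a ha
    rw [mem_vanishingIdeal_iff]
    intro z hz
    exact (mem_zeroLocus_iff.1 hz.1) a ha

end GenericPoint

/-! ### Clearing denominators in `h ∘ [M]` -/

section Laurent

variable {n : ℕ}

/-- **Clearing denominators.** For `h ∈ F[X, Y]` and an integer matrix `M`, there are `N ∈ ℕ`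
and `a ∈ F[X, Y]` such that `h([M] z) · (∏ᵢ yᵢ)^N = a(z)` for every point `z = (x, y)` of the
torus locus of every extension field `C` of `F` (the multiplicative coordinates of `[M] z` are
Laurent monomials `∏ yⱼ^{Mᵢⱼ}`). The fields `C` range over the universe of `F`: one and the same
witness `(N, a)` is used below both at points of `F` and at generic points in extension fields
`E`, which is why the `Image` section takes `E` in the universe of `F`. [folklore] -/
theorem exists_mul_prod_pow_eq_aeval (M : Matrix (Fin n) (Fin n) ℤ)
    (h : MvPolynomial (Fin n ⊕ Fin n) F) :
    ∃ (N : ℕ) (a : MvPolynomial (Fin n ⊕ Fin n) F), ∀ {C : Type u} [Field C] [Algebra F C]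
      (z : Fin n ⊕ Fin n → C), z ∈ torusLocus C n →
      aeval (matrixAct M z) h * (∏ i, z (Sum.inr i)) ^ N = aeval z a := by
  classical
  induction h using MvPolynomial.induction_on with
  | C c =>
    refine ⟨0, MvPolynomial.C c, fun z _ => ?_⟩
    simp
  | add p q hp hq =>
    obtain ⟨N₁, a₁, h₁⟩ := hp
    obtain ⟨N₂, a₂, h₂⟩ := hq
    refine ⟨N₁ + N₂, a₁ * (∏ i, X (Sum.inr i)) ^ N₂ + a₂ * (∏ i, X (Sum.inr i)) ^ N₁,
      fun z hz => ?_⟩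
    have e : aeval z (∏ i, X (Sum.inr i) : MvPolynomial (Fin n ⊕ Fin n) F) = ∏ i, z (Sum.inr i) := by
      rw [map_prod]; simp only [aeval_X]
    rw [map_add, add_mul, map_add, map_mul, map_mul, map_pow, map_pow, e, ← h₁ z hz, ← h₂ z hz,
      pow_add]
    ring
  | mul_X p j hp =>
    obtain ⟨N₁, a₁, h₁⟩ := hp
    cases j with
    | inl i =>
      refine ⟨N₁, a₁ * ∑ k, MvPolynomial.C ((M i k : ℤ) : F) * X (Sum.inl k), fun z hz => ?_⟩
      rw [map_mul, aeval_X, matrixAct_inl, mul_right_comm, h₁ z hz, map_mul, map_sum]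
      congr 1
      refine Finset.sum_congr rfl fun k _ => ?_
      rw [map_mul, aeval_C, aeval_X, map_intCast]
    | inr i =>
      -- make all exponents non-negative with `N' = ∑ₖ |Mᵢₖ|`
      set N' : ℕ := ∑ k, (M i k).natAbs with hN'
      refine ⟨N₁ + N', a₁ * ∏ k, X (Sum.inr k) ^ (M i k + N').toNat, fun z hz => ?_⟩
      have hz' : ∀ k, z (Sum.inr k) ≠ 0 := hz
      have hnonneg : ∀ k, 0 ≤ M i k + N' := fun k => by
        have hk : (M i k).natAbs ≤ N' :=
          hN' ▸ Finset.single_le_sum (f := fun j => (M i j).natAbs) (fun j _ => Nat.zero_le _)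
            (Finset.mem_univ k)
        have hk' : ((M i k).natAbs : ℤ) ≤ (N' : ℤ) := by exact_mod_cast hk
        have habs : -((M i k).natAbs : ℤ) ≤ M i k := by
          rw [Int.natCast_natAbs]; exact neg_abs_le _
        omega
      rw [map_mul, aeval_X, matrixAct_inr, pow_add, map_mul, map_prod]
      simp only [map_pow, aeval_X]
      -- LHS = (aeval p * (∏ z)^N₁) * ((∏ₖ zₖ^{Mᵢₖ}) * (∏ z)^N')
      have key : (∏ k, z (Sum.inr k) ^ M i k) * (∏ k, z (Sum.inr k)) ^ N' =
          ∏ k, z (Sum.inr k) ^ (M i k + N').toNat := by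
        rw [← Finset.prod_pow, ← Finset.prod_mul_distrib]
        refine Finset.prod_congr rfl fun k _ => ?_
        rw [← zpow_natCast, ← zpow_add₀ (hz' k), ← zpow_natCast]
        congr 1
        rw [Int.toNat_of_nonneg (hnonneg k)]
      calc aeval (matrixAct M z) p * (∏ k, z (Sum.inr k) ^ M i k) *
            ((∏ k, z (Sum.inr k)) ^ N₁ * (∏ k, z (Sum.inr k)) ^ N')
          = (aeval (matrixAct M z) p * (∏ k, z (Sum.inr k)) ^ N₁) *
              ((∏ k, z (Sum.inr k) ^ M i k) * (∏ k, z (Sum.inr k)) ^ N') := by ring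
        _ = aeval z a₁ * ∏ k, z (Sum.inr k) ^ (M i k + N').toNat := by rw [h₁ z hz, key]

end Laurent

/-! ### Images under `[M]`: vanishing ideal and dimension -/

section Image

variable {n : ℕ} (P : Ideal (MvPolynomial (Fin n ⊕ Fin n) F)) [P.IsPrime] [IsAlgClosed F]
variable {E : Type u} [Field E] [Algebra F E] {ξ : Fin n ⊕ Fin n → E}

/-- **Polynomials vanishing on `[M](Z(P) ∩ Gⁿ)` are those vanishing at `[M] ξ`**, `ξ` any generic
point of `Z(P)` over `F`: `h` vanishes on the image iff `h([M] ξ) = 0`. (Clear denominators: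
`h([M] z) (∏ y)^N = a(z)`; then `h` vanishes on the image iff `a` vanishes on `Z(P) ∩ Gⁿ` iff
`a ∈ P` iff `a(ξ) = 0` iff `h([M] ξ) = 0`, as `∏ ξ_y ≠ 0`.) [cite: BaysKirby2018ANT, Prop. 7.3 (proof)] -/
theorem mem_vanishingIdeal_image_matrixAct_iff (hξ : IsGenericPt P ξ)
    (hne : (zeroLocus F P ∩ torusLocus F n).Nonempty)
    (M : Matrix (Fin n) (Fin n) ℤ) (h : MvPolynomial (Fin n ⊕ Fin n) F) :
    h ∈ vanishingIdeal F (matrixAct M '' (zeroLocus F P ∩ torusLocus F n)) ↔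
      aeval (matrixAct M ξ) h = 0 := by
  obtain ⟨N, a, hNa⟩ := exists_mul_prod_pow_eq_aeval M h
  have hξT : ξ ∈ torusLocus E n := hξ.mem_torusLocus P (X_inr_notMem_of_nonempty P hne)
  have hprodξ : (∏ i, ξ (Sum.inr i)) ^ N ≠ 0 :=
    pow_ne_zero _ (Finset.prod_ne_zero_iff.2 fun i _ => hξT i)
  constructor
  · intro hh
    -- `a` vanishes on `Z(P) ∩ Gⁿ`, so `a ∈ P`, so `a(ξ) = 0`
    have ha : a ∈ P := by
      rw [← vanishingIdeal_zeroLocus_inter_torusLocus P hne, mem_vanishingIdeal_iff]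
      intro z hz
      rw [← hNa z hz.2, (mem_vanishingIdeal_iff.1 hh) _ ⟨z, hz, rfl⟩, zero_mul]
    have := hNa ξ hξT
    rw [(hξ a).2 ha] at this
    exact (mul_eq_zero.1 this).resolve_right hprodξ
  · intro hh
    rw [mem_vanishingIdeal_iff]
    rintro _ ⟨z, hz, rfl⟩
    have ha : a ∈ P := by
      rw [← hξ a, ← hNa ξ hξT, hh, zero_mul]
    have h0 : aeval z a = 0 := (mem_zeroLocus_iff.1 hz.1) a ha
    have := hNa z hz.2
    rw [h0] at this
    exact (mul_eq_zero.1 this).resolve_right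
      (pow_ne_zero _ (Finset.prod_ne_zero_iff.2 fun i _ => hz.2 i))

/-- The vanishing ideal of `[M](Z(P) ∩ Gⁿ)` is the kernel of evaluation at `[M] ξ`. [cite: BaysKirby2018ANT, Prop. 7.3 (proof)] -/
theorem vanishingIdeal_image_matrixAct_eq_ker (hξ : IsGenericPt P ξ)
    (hne : (zeroLocus F P ∩ torusLocus F n).Nonempty) (M : Matrix (Fin n) (Fin n) ℤ) :
    vanishingIdeal F (matrixAct M '' (zeroLocus F P ∩ torusLocus F n)) =
      RingHom.ker (aeval (matrixAct M ξ) : MvPolynomial (Fin n ⊕ Fin n) F →ₐ[F] E) := by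
  ext h
  rw [mem_vanishingIdeal_image_matrixAct_iff P hξ hne, RingHom.mem_ker]

/-- `[M] ξ` is a generic point of the Zariski closure of `[M](Z(P) ∩ Gⁿ)`: its ideal over `F` is
the vanishing ideal of the image. [cite: BaysKirby2018ANT, Prop. 7.3 (proof)] -/
theorem IsGenericPt.matrixAct (hξ : IsGenericPt P ξ)
    (hne : (zeroLocus F P ∩ torusLocus F n).Nonempty) (M : Matrix (Fin n) (Fin n) ℤ) :
    IsGenericPt (vanishingIdeal F (matrixAct M '' (zeroLocus F P ∩ torusLocus F n)))
      (matrixAct M ξ) := fun h =>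
  (mem_vanishingIdeal_image_matrixAct_iff P hξ hne M h).symm

/-- **Dimension of `[M]·V` as a transcendence degree**: for `V = Z(P) ∩ Gⁿ ≠ ∅` and `ξ` a generic
point of `Z(P)`, `zariskiDim F ([M](V)) = trdeg_F F[[M] ξ]`, the transcendence degree of the
`F`-subalgebra generated by the coordinates of `[M] ξ` (Bays–Kirby 2018, proof of Prop. 7.3:
`dim (M·V)^{Zar} = td(M·b/A)` for `b` generic). [cite: BaysKirby2018ANT, Prop. 7.3 (proof)] -/
theorem zariskiDim_image_matrixAct_eq (hξ : IsGenericPt P ξ)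
    (hne : (zeroLocus F P ∩ torusLocus F n).Nonempty) (M : Matrix (Fin n) (Fin n) ℤ) :
    zariskiDim F (matrixAct M '' (zeroLocus F P ∩ torusLocus F n)) =
      (Cardinal.toNat (Algebra.trdeg F
        (aeval (matrixAct M ξ) : MvPolynomial (Fin n ⊕ Fin n) F →ₐ[F] E).range) :
          WithBot ℕ∞) := by
  haveI : (RingHom.ker (aeval (matrixAct M ξ) :
      MvPolynomial (Fin n ⊕ Fin n) F →ₐ[F] E)).IsPrime := RingHom.ker_isPrime _
  rw [← zariskiDim_zeroLocus_ker, zariskiDim, zariskiDim,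
    vanishingIdeal_image_matrixAct_eq_ker P hξ hne, MvPolynomial.IsPrime.vanishingIdeal_zeroLocus (K := F)]

/-- **Lower bound for `dim [M]·V` by algebraically independent coordinates**: if `r` elements of
`F[[M] ξ]` are algebraically independent over `F` then `r ≤ zariskiDim F ([M](V))` — the form in
which rotundity `dim [M]·V ≥ rk M` is checked from `td(M·b/A) ≥ rk M`. [cite: BaysKirby2018ANT, Prop. 7.3 (proof)] -/
theorem le_zariskiDim_image_matrixAct (hξ : IsGenericPt P ξ)
    (hne : (zeroLocus F P ∩ torusLocus F n).Nonempty) (M : Matrix (Fin n) (Fin n) ℤ) {r : ℕ}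
    (w : Fin r → (aeval (matrixAct M ξ) : MvPolynomial (Fin n ⊕ Fin n) F →ₐ[F] E).range)
    (hw : AlgebraicIndependent F w) :
    (r : WithBot ℕ∞) ≤ zariskiDim F (matrixAct M '' (zeroLocus F P ∩ torusLocus F n)) := by
  rw [zariskiDim_image_matrixAct_eq P hξ hne]
  set φ := (aeval (matrixAct M ξ) : MvPolynomial (Fin n ⊕ Fin n) F →ₐ[F] E) with hφ
  haveI : Algebra.FiniteType F φ.range :=
    Algebra.FiniteType.of_surjective φ.rangeRestrict (AlgHom.rangeRestrict_surjective φ)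
  have hfin : Algebra.trdeg F φ.range = Cardinal.toNat (Algebra.trdeg F φ.range) :=
    Literature.RingTheory.KrullDimension.trdeg_eq_toNat F φ.range
  have hle := hw.lift_cardinalMk_le_trdeg
  rw [Cardinal.mk_fin, Cardinal.lift_natCast, hfin, Cardinal.lift_natCast] at hle
  exact_mod_cast hle

/-- Algebraically independent values of polynomials at `[M] ξ` bound `dim [M]·V` from below
(variant of `le_zariskiDim_image_matrixAct` with the witnesses given as polynomials).
[cite: BaysKirby2018ANT, Prop. 7.3 (proof)] -/
theorem le_zariskiDim_image_matrixAct' (hξ : IsGenericPt P ξ)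
    (hne : (zeroLocus F P ∩ torusLocus F n).Nonempty) (M : Matrix (Fin n) (Fin n) ℤ) {r : ℕ}
    (g : Fin r → MvPolynomial (Fin n ⊕ Fin n) F)
    (hg : AlgebraicIndependent F fun k => aeval (matrixAct M ξ) (g k)) :
    (r : WithBot ℕ∞) ≤ zariskiDim F (matrixAct M '' (zeroLocus F P ∩ torusLocus F n)) := by
  set φ := (aeval (matrixAct M ξ) : MvPolynomial (Fin n ⊕ Fin n) F →ₐ[F] E) with hφ
  let w : Fin r → φ.range := fun k => ⟨φ (g k), ⟨g k, rfl⟩⟩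
  have hw : AlgebraicIndependent F w :=
    AlgebraicIndependent.of_comp φ.range.val (by simpa [w, Function.comp_def] using hg)
  exact le_zariskiDim_image_matrixAct P hξ hne M w hw

/-- **Upper bound**: `dim [M]·V ≤ trdeg_F E` for any field `E` carrying a generic point (e.g.
`E = F(V)`, where `trdeg_F F(V) = dim V`). [cite: BaysKirby2018ANT, Prop. 7.3 (proof)] -/
theorem zariskiDim_image_matrixAct_le_trdeg (hξ : IsGenericPt P ξ)
    (hne : (zeroLocus F P ∩ torusLocus F n).Nonempty) (M : Matrix (Fin n) (Fin n) ℤ) {d : ℕ}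
    (hd : Algebra.trdeg F E ≤ d) :
    zariskiDim F (matrixAct M '' (zeroLocus F P ∩ torusLocus F n)) ≤ d := by
  rw [zariskiDim_image_matrixAct_eq P hξ hne]
  set φ := (aeval (matrixAct M ξ) : MvPolynomial (Fin n ⊕ Fin n) F →ₐ[F] E) with hφ
  haveI : Algebra.FiniteType F φ.range :=
    Algebra.FiniteType.of_surjective φ.rangeRestrict (AlgHom.rangeRestrict_surjective φ)
  have h1 : Algebra.trdeg F φ.range ≤ Algebra.trdeg F E :=
    trdeg_le_of_injective φ.range.val Subtype.val_injective
  have hfinB : Algebra.trdeg F φ.range = Cardinal.toNat (Algebra.trdeg F φ.range) :=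
    Literature.RingTheory.KrullDimension.trdeg_eq_toNat F φ.range
  rw [hfinB] at h1
  exact_mod_cast h1.trans hd

omit [IsAlgClosed F] in
/-- `trdeg_F F(V) = trdeg_F F[V]`: a transcendence basis of the coordinate ring is one of the
function field. [folklore] -/
theorem trdeg_zeroLocusFunctionField_eq :
    Algebra.trdeg F (zeroLocusFunctionField P) = Algebra.trdeg F (zeroLocusCoordRing P) := by
  haveI : FaithfulSMul F (zeroLocusCoordRing P) :=
    (faithfulSMul_iff_algebraMap_injective F (zeroLocusCoordRing P)).2 (algebraMap F (zeroLocusCoordRing P)).injective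
  obtain ⟨s, hs⟩ := exists_isTranscendenceBasis F (zeroLocusCoordRing P)
  haveI : Algebra.IsAlgebraic (zeroLocusCoordRing P) (zeroLocusFunctionField P) :=
    IsLocalization.isAlgebraic (zeroLocusFunctionField P) (nonZeroDivisors (zeroLocusCoordRing P))
  have hs' := hs.algebraMap_comp (A := zeroLocusFunctionField P)
  rw [← hs.cardinalMk_eq_trdeg, ← hs'.cardinalMk_eq_trdeg]

/-- `zariskiDim F Z(P) = trdeg_F F(V)` read through `toNat`. [cite: Matsumura1987, Thm 5.6] -/
theorem zariskiDim_zeroLocus_eq_trdeg_zeroLocusFunctionField :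
    zariskiDim F (zeroLocus F P) =
      (Cardinal.toNat (Algebra.trdeg F (zeroLocusFunctionField P)) : WithBot ℕ∞) := by
  rw [zariskiDim_zeroLocus_eq_trdeg, trdeg_zeroLocusFunctionField_eq]

/-- **Upper bound**: `dim [M]·V ≤ dim V`. [cite: BaysKirby2018ANT, Prop. 7.3 (proof)] -/
theorem zariskiDim_image_matrixAct_le (hne : (zeroLocus F P ∩ torusLocus F n).Nonempty)
    (M : Matrix (Fin n) (Fin n) ℤ) :
    zariskiDim F (matrixAct M '' (zeroLocus F P ∩ torusLocus F n)) ≤ zariskiDim F (zeroLocus F P) := by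
  have hfin : Algebra.trdeg F (zeroLocusFunctionField P) =
      Cardinal.toNat (Algebra.trdeg F (zeroLocusFunctionField P)) := by
    rw [trdeg_zeroLocusFunctionField_eq]; exact Literature.RingTheory.KrullDimension.trdeg_eq_toNat F (zeroLocusCoordRing P)
  rw [zariskiDim_zeroLocus_eq_trdeg_zeroLocusFunctionField]
  refine zariskiDim_image_matrixAct_le_trdeg P (isGenericPt_genericPt P) hne M ?_
  exact hfin.le

end Image

end Literature.NumberTheory.Transcendental
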